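import Summits.QuantumFields.YangMills.Theorems.BalabanUVNodesN05SubBP2DSlotExistsGuarded
import Summits.QuantumFields.YangMills.Theorems.BalabanUVNodesN05SubBP2DK2SlotGammaPrime
import Literature.MathematicalPhysics.QuantumFieldTheory.Balaban1983to89.Node00.CarriersB8SubBPCutP5Kappa

/-!
# BalabanUVNodes ∕ N05 ([Balaban1985RegularSpaces] Lemma 1 p. 79 – Thm 8 p. 101, Prop. 5 p. 94, (1.3)–(1.5) p. 77): EDITION «K2» OF THE GUARDED «P₂D» ROOT — THE κ-CUT SLOT AT THE
# κ-CUT P₅-PIN INHABITED FROM [4]-TYPE LETTERS AND SOCKETS AT PRINT-CLASS MEMBERS ONLY (director-ym №227 (b′-2); plan YMPLAN-G87-N05-GO (R2))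

Track A of `YM-PLAN.md` (cell `pub-ymgap`, HUMAN RULING D-0062), node **N05**; seat `pub-ymgap-dag-n05-d` (g14, (R2) pen), 2026-08-28; bears on K1⁹ `stmt-QuantumFields-27364`
(`--supports … --as helper`, count-neutral).

WHAT.  p638230's guarded root `…SlotExistsGuarded.exists_residB8_b8LeafOfRecordSubBP₂D_cutSubBP₅_of_lettersSrc_γ'_guarded` RE-KEYED onto PRINT's (1.3)–(1.4) CLASS AT THE PINNED
`(Mκ, Rκ)` on BOTH sides: every [Balaban1985BackgroundPropagators]-type binder (`SLet ∕ SLetUB ∕ SB9P ∕ SH59src ∕ SB9srcHP`) gains print's literal (1.3)–(1.4)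
«`Admissible134 θ.L Mκ Rκ i.k i.Ω`» as ONE extra member hypothesis after the (1.5) law (N06 serves ONLY print's class — Q-SG1 «SURVIVES»); the layer is this seat's
κ-cut P₅-pin `λ.cutSubBP₅κ Mκ Rκ c₁ ρ₀` ((R1), `Node00/CarriersB8SubBPCutP5Kappa`: Proposition 5's index `IdxB8LanCκ θ Mκ Rκ`); the conclusion is dag-n05-w1's κ-cut slot
`B8LeafOfRecordSubBP₂Dκ θ Mκ Rκ (lam.cutSubBP₅κ Mκ Rκ c₁ ρ₀)` (`Node00/CarriersB8SubDKappa`) — EVERY index the slot quantifies over is print's class at the pinned `Mκ`.  Proof = p638230's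
VERBATIM on the «K2» knit `…K2SlotGammaPrime.b8LeafOfRecordSubBP₂DK2_cutSubBP_zdLan_printCube_of_knit_lettersSrc_γ'` at `ι := IdxB8LanCκ.toZdLanIdx` (the κ-pin's faces), the layer
`exists_residB8_layer_guarded` (p638230 §1, BY NAME), the κ-pin's `Iff.rfl` face `b8LeafOfRecordSubBP₂Dκ_cutSubBP₅κ_iff_cutSubBP`.
WHAT IS PROVED: ★★★ `exists_residB8_b8LeafOfRecordSubBP₂Dκ_cutSubBP₅κ_of_lettersSrc_γ'_guarded` — p638230's hypotheses with the κ member hypothesis, `(Mκ Rκ : ℕ)` ⊢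
`∃ lam c₁ ρ₀, 0 < c₁ ∧ 1 ≤ ρ₀ ∧ B8LeafOfRecordSubBP₂Dκ θ Mκ Rκ (lam.cutSubBP₅κ Mκ Rκ c₁ ρ₀)`.
HONEST FRAMING: composition BY NAME; 0 estimates of Bałaban's proved here; letters ∕ sockets remain HYPOTHESES at the PRINT-CLASS (1.3)–(1.5) `Ω₀ = ℤᵈ` law members ([4] content =
N06, `m ≥ 1` OPEN) — ℤᵈ (infinite-volume) statements: under director-ym №227 (b) this row is the BANKED conditional twin, the discharge road is the guarded-socket package;
count-neutral; **N05 NOT discharged**; K1⁹ NOT claimed; Bałaban AS PRINTED; one finite 𝕋⁴ programme at fixed ε; nothing continuum ∕ ℝ⁴ ∕ OS ∕ mass-gap ∕ Clay.  No `sorry`, no new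
definition.  Unit `pub-ymgap-dag-n05-d` (g14).
[cite: Balaban1985RegularSpaces, Lemma 1 p.79, Thm 2 p.83, Prop. 3 p.87, Thm 4 p.88, Prop. 5 p.94, Prop. 6 (1.134)–(1.138) p.99, Prop. 7 p.100, Thm 8 (1.146) p.101, (1.3)–(1.5) p.77; Balaban1985BackgroundPropagators, Thm 3.1 p.397, Thm 3.3 p.399, (3.40) p.397]
-/

noncomputable section

namespace Summit.QuantumFields.YangMills.BalabanUVNodes.N05SubBP2DK2SlotExistsGuarded

open Literature.MathematicalPhysics.QuantumFieldTheory.Balaban1983to89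
open Literature.MathematicalPhysics.QuantumFieldTheory.Balaban1983to89.Node00
open Literature.MathematicalPhysics.QuantumFieldTheory.Balaban1983to89.B8IdxB8LawsB (IdxB8LawsB IdxB8SubB)
open Literature.MathematicalPhysics.QuantumFieldTheory.Balaban1983to89.B8LeafModelZd (ZdIdx)
open Literature.MathematicalPhysics.QuantumFieldTheory.Balaban1983to89.B8LeafModelZd3 (SockB9P3)
open Literature.MathematicalPhysics.QuantumFieldTheory.Balaban1983to89.B9SupplySockB9P3ZdGammaUnivDelta2 (SockB9P3H2)
open Literature.MathematicalPhysics.QuantumFieldTheory.Balaban1983to89.B8LeafModelZd3P (zdGF3P zdGF3HP)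
open Literature.MathematicalPhysics.QuantumFieldTheory.Balaban1983to89.B8LeafModelZd3P2 (zdGF3P₂ zdGF3HP₂)
open Literature.MathematicalPhysics.QuantumFieldTheory.Balaban1983to89.B8TowerBondsPrinted (towerBondsP)
open Literature.MathematicalPhysics.QuantumFieldTheory.Balaban1983to89.B8SockLettersRD (SockLettersRD)
open Literature.MathematicalPhysics.QuantumFieldTheory.Balaban1983to89.B8Lemma1NonAbelian (mulCfg blockPairNA)
open Literature.MathematicalPhysics.QuantumFieldTheory.Balaban1983to89.B8LanF146 (LanF146)
open Literature.MathematicalPhysics.QuantumFieldTheory.Balaban1983to89.B8Eq138LandauZd (covLap QT InR138 IsLandau146W)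
open Literature.MathematicalPhysics.QuantumFieldTheory.Balaban1983to89.B8Prop5LandauDataZd (ZdLanIdx zdLan)
open Summit.QuantumFields.YangMills.BalabanUVNodes.N05SubBP2DK2SlotGammaPrime (b8LeafOfRecordSubBP₂DK2_cutSubBP_zdLan_printCube_of_knit_lettersSrc_γ')
open Summit.QuantumFields.YangMills.BalabanUVNodes.N05SubBP2DSlotExistsGuarded (exists_residB8_layer_guarded)
open Literature.MathematicalPhysics.QuantumFieldTheory.Balaban1983to89.B8Eq134Admissible (Admissible134)
open MatrixLog B7Prop1Explicit B7Prop2Explicit B7Prop1Local B7Eq92Concrete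
open B8Ineq130 (tlo thi)
open B8Ineq132 (InAk covDerivFwd)
open B7Eq78Linearization (zdBlocking QprimeIter)
open B8Eq119TwistedAxial (bgT Restr129 InAx)
open B8Eq140Level (SideTouches)
open B8Eq1117Concrete (XSpace)
open B8Prop5ContractionKLevel (Bd2)
open B8LambdaSpaceKLevel (wt)
open B8Eq184Proof (gaugeExp cfgExp)
open B8Eq146AExpansion (iEta plaqCovDeriv)
open B8Eq143PlaqExpansion (pdiv)
open B7Prop4GeneralLevels (linCovIter)
open B8Eq155JBound (Jcur wsup)
open B8ScaledSupNorm (bondNorm msup Bdd)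
open B9Eq340HolderZd (hquot AdmPair)

-- `Site` alone could resolve to the torus sites of `Setup.lean`; re-export the `ℤ^d` sites of `B7Prop1Explicit`.
export B7Prop1Explicit (Site)

open Literature.MathematicalPhysics.QuantumFieldTheory.Balaban1983to89.B8Prop6PrintedZdCubPGamma (prop6Printed_zdCubP_γ_holds_record_dvd)
open B8ScaledSupNorm (msup_le bdd_of_forall)
open Literature.MathematicalPhysics.QuantumFieldTheory.Balaban1983to89.B8LanF146 (lanF146_zero_iff)
open Literature.MathematicalPhysics.QuantumFieldTheory.Balaban1983to89.B8Eq138LandauZd (inR138_zero)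
open Literature.MathematicalPhysics.QuantumFieldTheory.Balaban1983to89.B8LeafKnitRSC (B8LeafRSC)
open Literature.MathematicalPhysics.QuantumFieldTheory.Balaban1983to89.B8Prop7TowerAxialRecord (toAxialTowerResid)

section SlotExistsLawLanGuarded

/-- ★★★ **GUARDED EDITION** (director-ym №217 (2)(i), ref-D VERDICT-415: the witness CARRIES `0 < c₁ ∧ 1 ≤ ρ₀`, so the Proposition-6 conjunct of the slot is NOT the vacuous `c₁ < 0` instance) of
★★★ **THE «P₂D» SLOT INHABITED AT dag-n05-w1's P₅-PINNED PRINT-CLASS CUT, FROM FIVE (1.5)-KEYED [4]-TYPE FAMILIES** — Proposition 5's family IS print's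
p. 94 family BY NAME (`λ.cutSubBP₅κ Mκ Rκ c₁ ρ₀`: index `IdxB8LanCκ θ Mκ Rκ` = ((1.3)–(1.5)-admissible `Ω₀ = ℤᵈ` law member, unitary background), members `zdLan θ.L λ.B₁ ∘ toZdLanIdx`),
so there is NO ∃ over Proposition 5's carriers and no certificate is needed.  For `θ` with `2 ≤ θ.D`, `5 ≤ θ.L`: [Balaban1985BackgroundPropagators]'s primitive
constants (positivity guards, `2 ≤ 5dLB₀`), its letters `SLet ∕ SLetUB` and the b9 sockets `SB9P ∕ SH59src ∕ SB9srcHP` at the (1.3)–(1.5)-admissible law members ⊢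
`∃ lam c₁ ρ₀, B8LeafOfRecordSubBP₂Dκ θ Mκ Rκ (lam.cutSubBP₅κ Mκ Rκ c₁ ρ₀)`.  Proof: `exists_residB8_layer` (p611162); ONE application of p618522's
`b8LeafOfRecordSubBP₂DK2_cutSubBP_zdLan_printCube_of_knit_lettersSrc_γ'` at `ι := IdxB8LanCκ.toZdLanIdx` with the pin's faces `IdxB8LanCκ.hΩ0L ∕ hΩL ∕ htowerL`,
`SLetL := SLet` at the member's top truncation (its (1.5) hypothesis := `a.1.mem.2`), `SLetLU := SLetUB`; the pin's `Iff.rfl` face `b8LeafOfRecordSubBP₂Dκ_cutSubBP₅κ_iff_cutSubBP`.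
Sockets ∕ letters are HYPOTHESES (N06); N05 NOT discharged. [cite: Balaban1985RegularSpaces, Lemma 1 – Thm 8 pp.79–101, Prop. 5 (1.106)–(1.110) p.94, (1.3)–(1.5) p.77; Balaban1985BackgroundPropagators, Thm 3.1 p.397, Thm 3.3 p.398, (3.40) p.397] -/
theorem exists_residB8_b8LeafOfRecordSubBP₂Dκ_cutSubBP₅κ_of_lettersSrc_γ'_guarded (θ : Stage3Params) (hD : 2 ≤ θ.D) (hL5 : 5 ≤ θ.L) (Mκ Rκ : ℕ)
    -- [Balaban1985BackgroundPropagators]'s PRIMITIVE constants read by the sockets: `B₀` (3.40), the Hölder pair `(β, B₀(β₀))` and length function, [4]'s letter bounds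
    {B₀ B₀β β : ℝ} {len : Site θ.D → ℝ}
    {cB9 B₀'H B₂' BG BR cL : ℝ}
    (hcB9 : 0 < cB9) (hB₀'H : 0 < B₀'H) (hB₂' : 0 ≤ B₂') (hBG : 0 ≤ BG) (hBR : 0 ≤ BR) (hcL : 0 < cL)
    -- [4]'s letters AT THE `Ω₀ = ℤᵈ` LAW MEMBERS ONLY: existence side (laws on print's domains) and uniqueness side
    (SLet : ∀ i : ZdIdx θ.D θ.L, i.Ω 0 = Set.univ → IdxB8LawsB θ.L i → B8ConstraintBonds.DomainSeq θ.L i.Ω → (∀ l, l < i.k → ∀ z ∈ i.Λs i.k l, ((θ.L : ℤ) ^ l) • z ∈ B8ConstraintBonds.Lam θ.L i.Ω l) → Admissible134 θ.L Mκ Rκ i.k i.Ω → SockLettersRD (𝔸 := θ.𝔸) θ.L BG BR B₀'H B₂' cL i.η i.k i.Ω i.Λs)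
    (SLetUB : ∀ i : ZdIdx θ.D θ.L, i.Ω 0 = Set.univ → IdxB8LawsB θ.L i → B8ConstraintBonds.DomainSeq θ.L i.Ω → (∀ l, l < i.k → ∀ z ∈ i.Λs i.k l, ((θ.L : ℤ) ^ l) • z ∈ B8ConstraintBonds.Lam θ.L i.Ω l) → Admissible134 θ.L Mκ Rκ i.k i.Ω → ∀ α₀ : ℝ, 0 < α₀ → α₀ ≤ cL → ∀ U₀ : Site θ.D → Fin θ.D → θ.𝔸ˣ, (∀ x κ, U₀ x κ ∈ unitaryUnits θ.𝔸) →
      InAk θ.L i.k i.η α₀ i.Ω U₀ →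
      ∃ (g Δ : (Site θ.D → θ.𝔸) →ₗ[ℂ] (Site θ.D → θ.𝔸)) (q : (Site θ.D → θ.𝔸) →ₗ[ℂ] (ℕ → Site θ.D → θ.𝔸))
        (qs : (ℕ → Site θ.D → θ.𝔸) →ₗ[ℂ] (Site θ.D → θ.𝔸)) (Aw c : (ℕ → Site θ.D → θ.𝔸) →ₗ[ℂ] (ℕ → Site θ.D → θ.𝔸))
        (H' : XSpace θ.D i.k θ.𝔸 →ₗ[ℂ] (Site θ.D → θ.𝔸)),
        (∀ x : Site θ.D → θ.𝔸, (∃ C : ℝ, ∀ y, ‖x y‖ ≤ C) → g (Δ x + qs (Aw (q x))) = x) ∧ (∀ φ, qs (c (q (g (g (qs φ))))) = qs φ) ∧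
        (∀ (f : Site θ.D → θ.𝔸), ∀ x ∈ i.Ω 0, Δ f x = covLap i.η U₀ ((i.Ω 0).indicator f) x) ∧
        (∀ (μ : ℕ → Site θ.D → θ.𝔸), ∀ x ∈ i.Ω 0, qs μ x = QT θ.L i.k (i.Λs i.k) U₀ μ x) ∧
        (∀ (f : Site θ.D → θ.𝔸) (n : ℕ), n ≤ i.k → ∀ y ∈ i.Λs i.k n, q f n y = QprimeIter (zdBlocking θ.D θ.L) (bgT θ.L U₀) n f y) ∧
        (∀ (f : Site θ.D → θ.𝔸) (n : ℕ) (y : Site θ.D), ¬ (n ≤ i.k ∧ y ∈ i.Λs i.k n) → q f n y = 0) ∧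
        (∀ (X : XSpace θ.D i.k θ.𝔸) (x : Site θ.D), ‖H' X x‖ ≤ B₀'H * ‖X‖) ∧
        (∀ n, n ≤ i.k → ∀ (X : XSpace θ.D i.k θ.𝔸), ∀ p ∈ {b : Site θ.D × Fin θ.D | SideTouches (i.Ω n) b.1 b.2},
          wt θ.L i.η n * ‖covDerivFwd i.η U₀ p.2 (H' X) p.1‖ ≤ B₀'H * ‖X‖) ∧
        (∀ X : XSpace θ.D i.k θ.𝔸, Bd2 θ.L i.η i.k i.Ω (covLap i.η U₀ (H' X)) (B₂' * ‖X‖)) ∧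
        (∀ (Y : XSpace θ.D i.k θ.𝔸) (n : ℕ) (hn : n ≤ i.k) (y : Site θ.D), y ∈ i.Λs i.k n →
          QprimeIter (zdBlocking θ.D θ.L) (bgT θ.L U₀) n (H' Y) y = Y (⟨n, Nat.lt_succ_of_le hn⟩, y)) ∧
        (∀ (f : Site θ.D → θ.𝔸) (r : ℝ), 0 ≤ r → Bd2 θ.L i.η i.k i.Ω f r →
          (∀ x, ‖g f x‖ ≤ BG * r) ∧ ∀ n, n ≤ i.k → ∀ p ∈ {b : Site θ.D × Fin θ.D | SideTouches (i.Ω n) b.1 b.2},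
            wt θ.L i.η n * ‖covDerivFwd i.η U₀ p.2 (g f) p.1‖ ≤ BG * r) ∧
        (∀ (f : Site θ.D → θ.𝔸) (r : ℝ), 0 ≤ r → Bd2 θ.L i.η i.k i.Ω f r → Bd2 θ.L i.η i.k i.Ω (f - g (qs (c (q (g f))))) (BR * r)))
    -- the SOURCELESS b9 socket of Proposition 3's frame over PRINT's class, at the law members only ([4] Thm 3.3; threshold `cB9`) — for Prop. 3 AS PRINTED
    (SB9P : ∀ i : ZdIdx θ.D θ.L, i.Ω 0 = Set.univ → IdxB8LawsB θ.L i → B8ConstraintBonds.DomainSeq θ.L i.Ω → (∀ l, l < i.k → ∀ z ∈ i.Λs i.k l, ((θ.L : ℤ) ^ l) • z ∈ B8ConstraintBonds.Lam θ.L i.Ω l) →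
      Admissible134 θ.L Mκ Rκ i.k i.Ω →
      SockB9P3H2 (𝔸 := θ.𝔸) θ.L B₀ B₀β cB9 β len i.η i.k i.Ω i.Λs (fun m j => towerBondsP θ.L i.Ω (i.Λs m) j))
    -- THEOREM 8's SOCKET-SIDE constants (source threshold `cP3`, source size factor `γ₈`, remainder slacks `γ′ γ″ γβ`) and the guard `2 ≤ 5dLB₀` on [4]'s `B₀` —
    -- NO layer equation, NO auxiliary `B₈ ∕ B₈β`, NO free-constant guard: those are CHOSEN ∕ DERIVED in the proof
    {cP3 γ₈ γ' γ'' γβ : ℝ} (hcP3 : 0 < cP3) (hγ₈ : 1 ≤ γ₈) (hγ' : 0 ≤ γ') (hγ'' : 0 ≤ γ'')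
    (hB : 2 ≤ 5 * (θ.D : ℝ) * θ.L * B₀) (hB₀β : 0 < B₀β)
    -- [Balaban1985BackgroundPropagators] Thm 3.3 WITH SOURCE in Theorem 4's frame at (1.146), γ′ letter, at the law members ONLY, asked RADIUS-UNIFORMLY: for every
    -- gauge-field radius scale `r ≥ 0` SOME threshold `c59 > 0` (print needs the one radius `r = O(B₁)`; [4] Thm 3.3 gives every `r` by shrinking its threshold) — HYPOTHESIS
    (SH59src : ∀ r : ℝ, 0 ≤ r → ∃ c59 : ℝ, 0 < c59 ∧ ∀ i : ZdIdx θ.D θ.L, i.Ω 0 = Set.univ → IdxB8LawsB θ.L i → B8ConstraintBonds.DomainSeq θ.L i.Ω → (∀ l, l < i.k → ∀ z ∈ i.Λs i.k l, ((θ.L : ℤ) ^ l) • z ∈ B8ConstraintBonds.Lam θ.L i.Ω l) → Admissible134 θ.L Mκ Rκ i.k i.Ω → ∀ α₀ α₁ : ℝ, 0 < α₀ → 0 < α₁ → α₀ + α₁ ≤ c59 →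
      ∀ U₀ U' : Site θ.D → Fin θ.D → θ.𝔸ˣ, (∀ x κ, U₀ x κ ∈ unitaryUnits θ.𝔸) → (∀ x κ, U' x κ ∈ unitaryUnits θ.𝔸) →
      ∀ φ : Site θ.D → θ.𝔸, ((InR138 θ.L i.k i.η (i.Ω 0) (i.Λs i.k) U₀ φ ∧ (∀ x, IsSelfAdjoint (φ x)) ∧ (∀ x, x ∉ i.Ω 0 → φ x = 0) ∧
          Bdd θ.L i.k i.η (-(2 : ℝ)) (fun j (x : Site θ.D) => x ∈ i.Ω j) φ) ∧
        msup θ.L i.k i.η (-(2 : ℝ)) (fun j (x : Site θ.D) => x ∈ i.Ω j) φ < γ₈ * (α₀ + α₁)) →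
      InAk θ.L i.k i.η α₀ i.Ω U₀ → InAk θ.L i.k i.η α₀ i.Ω (mulCfg U' U₀) → (∀ m, m ≤ i.k → InAx θ.L m (i.Λs m) U₀ (mulCfg U' U₀)) →
      (∀ j, j ≤ i.k → ∀ (z : Site θ.D) (μ : Fin θ.D),
        ((∀ x, InBox (tlo θ.L z j) (thi θ.L z j) x → x ∈ i.Ω j) ∨ (∀ x, InBox (tlo θ.L (z + e μ) j) (thi θ.L (z + e μ) j) x → x ∈ i.Ω j)) →
        ‖(avgIter θ.L (mulCfg U' U₀) j z μ : θ.𝔸) - (avgIter θ.L U₀ j z μ : θ.𝔸)‖ ≤ α₁) →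
      (∀ b ∈ {b : Site θ.D × Fin θ.D | SideTouches (i.Ω 0) b.1 b.2}, ‖((U' b.1 b.2 : θ.𝔸ˣ) : θ.𝔸) - 1‖ ≤ α₁) →
      (∀ m, 1 ≤ m → m ≤ i.k → ∀ (u : Site θ.D → θ.𝔸ˣ) (W : Site θ.D → Fin θ.D → θ.𝔸ˣ) (A' : Site θ.D → Fin θ.D → θ.𝔸),
        (∀ x, u x ∈ unitaryUnits θ.𝔸) → mgauge U₀ u W = U' → Restr129 θ.L m (i.Λs m) U₀ u → LanF146 θ.L i.k i.η (i.Ω 0) i.Λs U₀ φ m W →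
        (∀ y τ, IsSelfAdjoint (A' y τ)) →
        (∀ j, j ≤ m → ∀ y τ, SideTouches (i.Ω j) y τ →
        W y τ = cfgExp i.η A' y τ ∧ ‖A' y τ‖ ≤ r * (α₀ + α₁) * ((θ.L : ℝ) ^ j * i.η)⁻¹) →
        (∀ y τ, (∀ j, j ≤ m → ¬ SideTouches (i.Ω j) y τ) → A' y τ = 0) →
        msup θ.L m i.η (-(1 : ℝ)) (fun j (b : Site θ.D × Fin θ.D) => SideTouches (i.Ω j) b.1 b.2) (fun b => A' b.1 b.2)
        ≤ B₀ * (bondNorm θ.L m i.η (-(3 : ℝ)) i.Ω (fun x μ => Jcur i.η U₀ A' μ x)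
        + wsup 1 (fun p : {p : ℕ × (Site θ.D × Fin θ.D) // p.1 ≤ m ∧ p.2 ∈ towerBondsP θ.L i.Ω (i.Λs m) p.1} =>
        linCovIter θ.L U₀ (iEta i.η A') p.1.1 p.1.2.1 p.1.2.2)) + γ' * B₀ * (α₀ + α₁) ∧
        msup θ.L m i.η (-(2 : ℝ)) (fun j (t : Fin θ.D × Fin θ.D × Site θ.D) => SideTouches (i.Ω j) t.2.2 t.2.1)
        (fun t => covDerivFwd i.η U₀ t.1 (fun z => A' z t.2.1) t.2.2)
        ≤ B₀ * (bondNorm θ.L m i.η (-(3 : ℝ)) i.Ω (fun x μ => Jcur i.η U₀ A' μ x)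
        + wsup 1 (fun p : {p : ℕ × (Site θ.D × Fin θ.D) // p.1 ≤ m ∧ p.2 ∈ towerBondsP θ.L i.Ω (i.Λs m) p.1} =>
        linCovIter θ.L U₀ (iEta i.η A') p.1.1 p.1.2.1 p.1.2.2)) + γ' * B₀ * (α₀ + α₁)))
    -- THE SOURCED b9 SOCKET OF PROPOSITION 3's FRAME at the `Ω₀ = ℤᵈ` law members, threshold `cP3`, `|B₁|` over print's class at the top truncation — HYPOTHESIS
    -- ([Balaban1985BackgroundPropagators] Thm 3.3 with source; = `B8Prop3SrcZd3HPGamma`'s input letter for letter)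
    (SB9srcHP : ∀ i : ZdIdx θ.D θ.L, i.Ω 0 = Set.univ → IdxB8LawsB θ.L i → B8ConstraintBonds.DomainSeq θ.L i.Ω → (∀ l, l < i.k → ∀ z ∈ i.Λs i.k l, ((θ.L : ℤ) ^ l) • z ∈ B8ConstraintBonds.Lam θ.L i.Ω l) → Admissible134 θ.L Mκ Rκ i.k i.Ω → ∀ α₀ α₁ α₂ : ℝ, 0 < α₀ → α₀ ≤ cP3 → 0 < α₁ → 0 < α₂ → α₂ ≤ cP3 →
      ∀ (U₀ W : Site θ.D → Fin θ.D → θ.𝔸ˣ), (∀ x κ, U₀ x κ ∈ unitaryUnits θ.𝔸) → (∀ x κ, W x κ ∈ unitaryUnits θ.𝔸) →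
      ∀ f : Site θ.D → θ.𝔸, InR138 θ.L i.k i.η (i.Ω 0) (i.Λs i.k) U₀ f →
      (∀ x, IsSelfAdjoint (f x)) → (∀ x, x ∉ i.Ω 0 → f x = 0) →
      Bdd θ.L i.k i.η (-(2 : ℝ)) (fun j (x : Site θ.D) => x ∈ i.Ω j) f →
      msup θ.L i.k i.η (-(2 : ℝ)) (fun j (x : Site θ.D) => x ∈ i.Ω j) f < γ₈ * (α₀ + α₁) →
      msup θ.L i.k i.η (-(3 : ℝ)) (fun j (p : Fin θ.D × Site θ.D) => p.2 ∈ i.Ω j) (fun p => covDerivFwd i.η U₀ p.1 f p.2) < γ₈ * (α₀ + α₁) →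
      InAk θ.L i.k i.η α₀ i.Ω U₀ → InAk θ.L i.k i.η α₀ i.Ω (mulCfg W U₀) → IsLandau146W θ.L i.k i.η (i.Ω 0) (i.Λs i.k) U₀ f W →
      ∀ A' : Site θ.D → Fin θ.D → θ.𝔸, (∀ y τ, IsSelfAdjoint (A' y τ)) →
      (∀ j, j ≤ i.k → ∀ (y : Site θ.D) (τ : Fin θ.D), SideTouches (i.Ω j) y τ →
        W y τ = cfgExp i.η A' y τ ∧ ‖A' y τ‖ ≤ α₂ * ((θ.L : ℝ) ^ j * i.η)⁻¹) →
      (∀ (y : Site θ.D) (τ : Fin θ.D), (∀ j, j ≤ i.k → ¬ SideTouches (i.Ω j) y τ) → A' y τ = 0) →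
      msup θ.L i.k i.η (-(1 : ℝ)) (fun j (b : Site θ.D × Fin θ.D) => SideTouches (i.Ω j) b.1 b.2) (fun b => A' b.1 b.2)
          ≤ B₀ * (bondNorm θ.L i.k i.η (-(3 : ℝ)) i.Ω (fun x μ => Jcur i.η U₀ A' μ x)
            + wsup 1 (fun p : {p : ℕ × (Site θ.D × Fin θ.D) // p.1 ≤ i.k ∧ p.2 ∈ towerBondsP θ.L i.Ω (i.Λs i.k) p.1} =>
                linCovIter θ.L U₀ (iEta i.η A') p.1.1 p.1.2.1 p.1.2.2)) + γ'' * B₀ * (α₀ + α₁) ∧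
        msup θ.L i.k i.η (-(2 : ℝ)) (fun j (t : Fin θ.D × Fin θ.D × Site θ.D) => SideTouches (i.Ω j) t.2.2 t.2.1)
            (fun t => covDerivFwd i.η U₀ t.1 (fun z => A' z t.2.1) t.2.2)
          ≤ B₀ * (bondNorm θ.L i.k i.η (-(3 : ℝ)) i.Ω (fun x μ => Jcur i.η U₀ A' μ x)
            + wsup 1 (fun p : {p : ℕ × (Site θ.D × Fin θ.D) // p.1 ≤ i.k ∧ p.2 ∈ towerBondsP θ.L i.Ω (i.Λs i.k) p.1} =>
                linCovIter θ.L U₀ (iEta i.η A') p.1.1 p.1.2.1 p.1.2.2)) + γ'' * B₀ * (α₀ + α₁) ∧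
        bondNorm θ.L i.k i.η (-(3 : ℝ)) i.Ω (fun x μ => pdiv i.η U₀ (plaqCovDeriv i.η U₀ A') μ x)
          ≤ B₀ * (bondNorm θ.L i.k i.η (-(3 : ℝ)) i.Ω (fun x μ => Jcur i.η U₀ A' μ x)
            + wsup 1 (fun p : {p : ℕ × (Site θ.D × Fin θ.D) // p.1 ≤ i.k ∧ p.2 ∈ towerBondsP θ.L i.Ω (i.Λs i.k) p.1} =>
                linCovIter θ.L U₀ (iEta i.η A') p.1.1 p.1.2.1 p.1.2.2)) + γ'' * B₀ * (α₀ + α₁) ∧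
        bondNorm θ.L i.k i.η (-(3 : ℝ)) i.Ω (fun x μ => covLap i.η U₀ (fun z => A' z μ) x)
          ≤ B₀ * (bondNorm θ.L i.k i.η (-(3 : ℝ)) i.Ω (fun x μ => Jcur i.η U₀ A' μ x)
            + wsup 1 (fun p : {p : ℕ × (Site θ.D × Fin θ.D) // p.1 ≤ i.k ∧ p.2 ∈ towerBondsP θ.L i.Ω (i.Λs i.k) p.1} =>
                linCovIter θ.L U₀ (iEta i.η A') p.1.1 p.1.2.1 p.1.2.2)) + γ'' * B₀ * (α₀ + α₁) ∧
        msup θ.L i.k i.η (-(2 + β)) (fun j (q : Fin θ.D × Fin θ.D × (Site θ.D × Site θ.D)) => q.2.2 ∈ AdmPair i.η len ∧ q.2.2.1 ∈ i.Ω j ∧ q.2.2.2 ∈ i.Ω j)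
            (fun q => hquot i.η β len U₀ (covDerivFwd i.η U₀ q.1 (fun z => A' z q.2.1)) q.2.2)
          ≤ B₀β * (bondNorm θ.L i.k i.η (-(3 : ℝ)) i.Ω (fun x μ => Jcur i.η U₀ A' μ x)
            + wsup 1 (fun p : {p : ℕ × (Site θ.D × Fin θ.D) // p.1 ≤ i.k ∧ p.2 ∈ towerBondsP θ.L i.Ω (i.Λs i.k) p.1} =>
                linCovIter θ.L U₀ (iEta i.η A') p.1.1 p.1.2.1 p.1.2.2)) + γβ * (α₀ + α₁)) :
    ∃ (lam : ResidB8 θ) (c₁ : ℝ) (ρ₀ : ℕ), 0 < c₁ ∧ 1 ≤ ρ₀ ∧ B8LeafOfRecordSubBP₂Dκ θ Mκ Rκ (lam.cutSubBP₅κ Mκ Rκ c₁ ρ₀) := by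
  -- the chosen constants and layer, GUARDED (`exists_residB8_layer_guarded` §1: `1 ≤ ρ₀`, `0 < c₁⋆` kept)
  obtain ⟨ρ₀, B₁s, c₁s, B₈, B₈β, lam, hρ₀, hc₁s, hP6, rfl, rfl, rfl, rfl, hC₂eq, hB₁', hB₁eq, hB₂eq, hB₁big, -, hB₀8, hγB, hγB'', hB8β, hfree2, hfreeS, hr0⟩ :=
    exists_residB8_layer_guarded θ hD hL5 (β := β) (len := len) (B₀β := B₀β) hBG hBR γβ hγ₈ hγ' hγ'' hB
  obtain ⟨c59, hc59, SH⟩ := SH59src _ hr0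
  -- PROPOSITION 5's family PINNED BY NAME: dag-n05-w1's `λ.cutSubBP₅κ Mκ Rκ c₁⋆ ρ₀` = the print-class cut at `(IdxB8LanCκ θ Mκ Rκ, zdLan θ.L λ.B₁ ∘ toZdLanIdx)` (`rfl`); the
  -- `zdLan` laws are the pin's faces, the `zdLan` letters are [4]'s letters AT THE MEMBER (`SLet` at the top truncation, `SLetUB` verbatim)
  refine ⟨lam, c₁s, ρ₀, hc₁s, hρ₀, (b8LeafOfRecordSubBP₂Dκ_cutSubBP₅κ_iff_cutSubBP lam c₁s ρ₀).2 ?_⟩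
  refine b8LeafOfRecordSubBP₂DK2_cutSubBP_zdLan_printCube_of_knit_lettersSrc_γ' lam Mκ Rκ hD hC₂eq hcB9 hB₀'H hB₂' hBG hBR hcL SLet SLetUB SB9P hfree2
      IdxB8LanCκ.toZdLanIdx IdxB8LanCκ.hΩ0L IdxB8LanCκ.hΩL IdxB8LanCκ.htowerL ?_ ?_ hP6 hB₁big hc59 hcP3 hγ₈ hγ' hγ'' hB hB₀β hB₀8 hγB hγB'' hB8β hB₁' hB₁eq hB₂eq
      hfreeS
      (fun i hΩ hl hd hlt hκ α₀ α₁ hα₀ hα₁ hαc U₀ U' hU₀ hU' φ hφ hIn hIn' hAx h135 hbd m hm1 hmk u W A' hu hg hR hLan hsa hW hA0 =>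
        SH i hΩ hl hd hlt hκ α₀ α₁ hα₀ hα₁ hαc U₀ U' hU₀ hU' φ hφ hIn hIn' hAx h135 hbd m hm1 hmk u W A' hu hg hR hLan hsa
          (fun j hj y τ hst => ⟨(hW j hj y τ hst).1, (hW j hj y τ hst).2.trans_eq (by ring)⟩) hA0)
      SB9srcHP
  · intro a α₀ hα₀ hαL hIn
    exact SLet a.1.mem.1.1.1.1 a.1.mem.1.1.1.2 a.1.mem.1.1.2 a.1.mem.1.2 a.1.mem.2 a.2 α₀ hα₀ hαL a.1.U₀ a.1.hU₀ hIn a.1.mem.1.1.1.1.k a.1.mem.1.1.1.1.hk le_rfl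
  · intro a α₀ hα₀ hαL hIn
    exact SLetUB a.1.mem.1.1.1.1 a.1.mem.1.1.1.2 a.1.mem.1.1.2 a.1.mem.1.2 a.1.mem.2 a.2 α₀ hα₀ hαL a.1.U₀ a.1.hU₀ hIn

end SlotExistsLawLanGuarded

end Summit.QuantumFields.YangMills.BalabanUVNodes.N05SubBP2DK2SlotExistsGuarded

end
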